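import Summits.AtomisticToContinuum.Crystallization.Theorems.ChargedEnergyGapBallWeights

/-!
# `PricedLinkCensus.ChargedEnergyGap` (stmt-AtomisticToContinuum-14231) — the BALL LEDGER beneath the engine target NGP: BALL ∧ FAR ⟹ NGP
# (decomp-a2c lens 3, generation 47, part I-B; over part I-A `ChargedEnergyGapBallWeights`; critic rows 894 / 901 (d)(i))

§3 THE LEDGER (exact, every parameter and scale `ϱ`): `ballExcess x = Σ_y ψ_x(y)(E_y − e*)`, `farExcess = Σ_y w(y)(E_y − e*)` over the
   motif (`E_y = siteEnergy`, `e* = eStar`); ★★ `excess Q = Σ_x ballExcess x + farExcess` (`excess_eq_ballExcess_add_farExcess`) — the ONE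
   allowed EQUIV of this node, an identity of numbers; ★ `Σ_x ballCoreCount x = #cores` (cores sit where `w = 0`); ★ `Σ_x ballOtherCount x
   + farOtherCount = #other = motifChargedGross − motifCoreIncoherent`.
§4 THE PIECES BENEATH NGP at a FIXED scale `ϱ` with ONE shared slack dial `c₁`, and the proved glue.
   BALL `CoreBallPricing θ ε R r η L δ L' ϱ c₁` := `∃ κ₀ > c₁, C₀ ≥ 0, ∀ Q, ∀ core x, κ₀·ballCoreCount x − C₀·ballOtherCount x ≤
   ballExcess x` — the smooth `ϱ`-ball around each incoherent core (core AND its elastic halo together: the only certifiable unit, MEMO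
   §3 finding F4 — a per-core-site credit with a per-uncharted-site debit is a constant race) pays MORE than the far slack `c₁` per
   weighted core inside, up to `C₀` per weighted other-species site inside.
   FAR `FarFloor θ ε R r η L δ L' ϱ c₁` := `∃ C₁ ≥ 0, ∀ Q, −C₁·farOtherCount − c₁·#cores ≤ farExcess` — away from all incoherent
   cores the smooth-weighted excess of charted matter and other species has a floor: a debit per weighted other-species site and a
   slack `c₁` per core.
   WHY A FIXED SCALE AND A SHARED SLACK (MEMO §2 (6), §3 F6): quantified uniformly over all large scales (`∃ κ₀ C₀ ϱ₁, ∀ ϱ ≥ ϱ₁`)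
   BALL would give NGP ON ITS OWN — at `ϱ ≥ 2·(covering radius of Q.lattice)` every bump is `≡ 1`, `w ≡ 0`, `ψ_x ≡ 1/#cores`, and
   the ball account IS the global account — so FAR would be decoration and the localisation cosmetic; at a fixed scale the far region
   of a long-period `Q` is real, BALL does not give NGP (MustFail) and FAR is load-bearing.  Sharing the slack `c₁` (BALL pays `> c₁`,
   FAR loses `≤ c₁` per core) makes the glue race-free without hand-picked thresholds inside either piece; both dials TURN
   (`CoreBallPricingOn.anti`, `FarFloor.mono`).
   ★★ `incoherentGrossDebitPricing_of_ball_far : BALL → FAR → NGP` (every parameter, scale and slack; `κ = κ₀ − c₁`, `C = C₀ + C₁`),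
   and at the record `(ϱ, c₁) = (160, 1/20)`, by name, down to `ChargedEnergyGap` (`chargedEnergyGap_of_ballLedger_record`, six
   leaves).  Typed ends
   `δ ≥ 5/8` (no cores, part H-A: BALL vacuous, FAR = `excess ≥ 0`).  Restriction to a sub-species `σ` of the cores, `CoreBallPricingOn … σ`,
   with the exact ∀-split `BALL ⟺ BALL|σ ∧ BALL|¬σ` (`coreBallPricing_iff_on_and_on_not`) — used by part J (the transmission cut).

⚠ GENERATION 48 ERRATUM (memo `g48/MEMO.md` §1).  BALL (every `σ`-restriction met by a core) and FAR are REFUTED AS TYPED by the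
«rim flower»: `M` mutually-crowded rattlers placed where an account's weight VANISHES, all bonded at distance `1` to one site where that
weight is POSITIVE, drive the account to `−∞` while its weighted debit stays `M`-independent (crowders are rattlers, hence exposed, hence
never cores: no new bump appears).  The exact ledger (§2–§3), the glue `BALL → FAR → NGP` and the record cone stay valid theorems; the two
leaves are dead as typed and the generation-47 tags below are kept for the record only.  The repair starts from the cool guard
(`…ChargedEnergyGapCoolGuard`: hot sites delete themselves, so every `∀ Q`-piece may assume no rattlers and `1/3`-separation for free)
and from debits that see a site's NEIGHBOURHOOD rather than the site's own weight (memo §4).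

TAGS (gen. 47).  BALL · not implied by NGP or by the crux (a localisation at scale 160) · does not give NGP alone (no control of the far account;
  MustFail) · UNDECIDED · INSTRUMENTABLE defect by defect (census L3-BALL: smooth `ϱ = 160` ball accounts of the L3-RIG-deep zoo) ·
  IDEA-NEEDED: for MONOLITHIC cores (misfit transmitted through charted matter) geometric rigidity + incompatibility + a core floor — of the
  known kind; for WALLED cores (high-angle grain boundaries, incoherent interfaces, misoriented inclusions, translation-domain walls) an AREA
  LAW for frustrated films between misoriented crystals — `TetrahedralFrustration`-ringed; part J types the cut.  BALL must pay MORE than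
  the far slack `c₁ = 1/20` per weighted core: margins `≈ 6` (dislocations), `> 1` (loops), `0.35–0.6` (high-angle grain boundaries),
  `0.2–0.3` (incoherent twin, the tightest) — MEMO §3 F6.
FAR · not implied by NGP or the crux · does not give NGP alone (no credit; MustFail) · TRUE-leaning · ATTACKABLE (L): Cauchy–Born
  POINTWISE — for a charted site `E_q − e* = [W_CB(F_q) − e*] + R_q` with `W_CB(F) − e* ≥ 0` exactly (the homogeneous lattice `F·Λ` is
  itself a periodic competitor for `e*`), so no smooth perturbation opens a first-order hole in the far account (the would-be «account
  transfer» `∫ δu·σ·∇w` across a stressed ball boundary completes a square site by site, MEMO §3 F6); what is left is the non-affinity /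
  strain-gradient remainder `R_q` — first order: zero-stress and centrosymmetry cancellations (`Σ_v V'(|v|) v̂ ⊗ v ⊗ v = 0` at
  centrosymmetric sites, layer-alternating at hcp-like ones), second order: harmonic localisation with commutator bounds for `√w` against
  the phonon gap of the Barlow charts — plus floors of the other species debited per weighted site, `r⁻⁶` tails; all inside the slack `c₁`
  (`≈ 10⁻²` per core pessimistically, F6).
All `[this work]`.
-/

noncomputable section

open scoped Classical
open Literature.MathematicalPhysics.StatisticalMechanics
open Literature.Geometry.DiscreteGeometry
open Summit.AtomisticToContinuum.Crystallization.Theses.PricedLinkCensus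
open Summit.AtomisticToContinuum.Crystallization.Theorems.ChargedEnergyGapNegative

namespace Summit.AtomisticToContinuum.Crystallization.Theorems.ChargedEnergyGapChartDial

/-! ## §3 The ledger: ball accounts, far account, and the three exact identities -/

section Ledger

variable (θ ε R r η L δ L' ϱ : ℝ)

/-- The **BALL ACCOUNT** of core `x`: `ψ_x`-weighted site excess over the motif. -/
def ballExcess (Q : PeriodicConfiguration 3) (x : Q.motif) : ℝ :=
  ∑ y : Q.motif, ballWeight θ ε R r η L δ L' ϱ Q x (y : E3) * (siteEnergy Q (y : E3) - eStar)

/-- The **FAR ACCOUNT**: `w`-weighted site excess over the motif. -/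
def farExcess (Q : PeriodicConfiguration 3) : ℝ :=
  ∑ y : Q.motif, farWeight θ ε R r η L δ L' ϱ Q (y : E3) * (siteEnergy Q (y : E3) - eStar)

/-- Weighted number of cores in the ball of `x` (the CREDIT count of BALL). -/
def ballCoreCount (Q : PeriodicConfiguration 3) (x : Q.motif) : ℝ :=
  ∑ y : Q.motif, if IsCore θ ε R r η L δ L' Q y then ballWeight θ ε R r η L δ L' ϱ Q x (y : E3) else 0

/-- Weighted number of other gross charged sites in the ball of `x` (the DEBIT count of BALL). -/
def ballOtherCount (Q : PeriodicConfiguration 3) (x : Q.motif) : ℝ :=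
  ∑ y : Q.motif, if IsOtherGross θ ε R r η L δ L' Q y then ballWeight θ ε R r η L δ L' ϱ Q x (y : E3) else 0

/-- Weighted number of other gross charged sites in the far region (the DEBIT count of FAR). -/
def farOtherCount (Q : PeriodicConfiguration 3) : ℝ :=
  ∑ y : Q.motif, if IsOtherGross θ ε R r η L δ L' Q y then farWeight θ ε R r η L δ L' ϱ Q (y : E3) else 0

variable {θ ε R r η L δ L' ϱ}

/-- The weighted core count of a ball is non-negative. -/
theorem ballCoreCount_nonneg (Q : PeriodicConfiguration 3) (x : Q.motif) : 0 ≤ ballCoreCount θ ε R r η L δ L' ϱ Q x :=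
  Finset.sum_nonneg fun y _ => by split_ifs; exacts [ballWeight_nonneg Q x _, le_rfl]

/-- The weighted other-gross count of a ball is non-negative. -/
theorem ballOtherCount_nonneg (Q : PeriodicConfiguration 3) (x : Q.motif) : 0 ≤ ballOtherCount θ ε R r η L δ L' ϱ Q x :=
  Finset.sum_nonneg fun y _ => by split_ifs; exacts [ballWeight_nonneg Q x _, le_rfl]

/-- The far-weighted other-gross count is non-negative. -/
theorem farOtherCount_nonneg (Q : PeriodicConfiguration 3) : 0 ≤ farOtherCount θ ε R r η L δ L' ϱ Q :=
  Finset.sum_nonneg fun y _ => by split_ifs; exacts [farWeight_nonneg Q _, le_rfl]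

/-- A non-core site has the zero ball account. -/
theorem ballExcess_of_not_isCore {Q : PeriodicConfiguration 3} {x : Q.motif} (hx : ¬ IsCore θ ε R r η L δ L' Q x) :
    ballExcess θ ε R r η L δ L' ϱ Q x = 0 := by
  simp [ballExcess, ballWeight_of_not_isCore hx]

/-- A non-core site has the zero weighted core count. -/
theorem ballCoreCount_of_not_isCore {Q : PeriodicConfiguration 3} {x : Q.motif} (hx : ¬ IsCore θ ε R r η L δ L' Q x) :
    ballCoreCount θ ε R r η L δ L' ϱ Q x = 0 := by
  simp [ballCoreCount, ballWeight_of_not_isCore hx]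

/-- A non-core site has the zero weighted other-gross count. -/
theorem ballOtherCount_of_not_isCore {Q : PeriodicConfiguration 3} {x : Q.motif} (hx : ¬ IsCore θ ε R r η L δ L' Q x) :
    ballOtherCount θ ε R r η L δ L' ϱ Q x = 0 := by
  simp [ballOtherCount, ballWeight_of_not_isCore hx]

/-- ★★ **THE LEDGER** (exact, every parameter and scale): `excess Q = Σ_x ballExcess x + farExcess`. -/
theorem excess_eq_ballExcess_add_farExcess (Q : PeriodicConfiguration 3) :
    excess Q = (∑ x : Q.motif, ballExcess θ ε R r η L δ L' ϱ Q x) + farExcess θ ε R r η L δ L' ϱ Q := by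
  have hx : excess Q = ∑ y : Q.motif, (siteEnergy Q (y : E3) - eStar) := by
    rw [excess_eq_sum, ← Finset.sum_coe_sort]
  rw [hx]
  simp only [ballExcess, farExcess]
  rw [Finset.sum_comm, ← Finset.sum_add_distrib]
  refine Finset.sum_congr rfl fun y _ => ?_
  rw [← Finset.sum_mul, ← add_mul, ballWeight_sum_add_farWeight, one_mul]

/-- ★ The credit counts add up to the number of cores EXACTLY (every core sits where `w = 0`). -/
theorem sum_ballCoreCount_eq (Q : PeriodicConfiguration 3) :
    (∑ x : Q.motif, ballCoreCount θ ε R r η L δ L' ϱ Q x) = (motifCoreIncoherent θ ε R r η L δ L' Q : ℝ) := by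
  rw [← sum_ite_isCore_eq θ ε R r η L δ L' Q]
  simp only [ballCoreCount]
  rw [Finset.sum_comm]
  refine Finset.sum_congr rfl fun y _ => ?_
  by_cases hy : IsCore θ ε R r η L δ L' Q y
  · simp only [hy, if_true]; exact ballWeight_sum_of_isCore hy
  · simp [hy]

/-- ★ The debit counts add up to the number of other gross charged sites EXACTLY. -/
theorem sum_ballOtherCount_add_farOtherCount_eq (Q : PeriodicConfiguration 3) :
    (∑ x : Q.motif, ballOtherCount θ ε R r η L δ L' ϱ Q x) + farOtherCount θ ε R r η L δ L' ϱ Q =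
      (Nat.card {x : Q.motif // IsOtherGross θ ε R r η L δ L' Q x} : ℝ) := by
  rw [← sum_ite_isOtherGross_eq θ ε R r η L δ L' Q]
  simp only [ballOtherCount, farOtherCount]
  rw [Finset.sum_comm, ← Finset.sum_add_distrib]
  refine Finset.sum_congr rfl fun y _ => ?_
  by_cases hy : IsOtherGross θ ε R r η L δ L' Q y
  · simp only [hy, if_true]; exact ballWeight_sum_add_farWeight Q _
  · simp [hy]

/-- The ball debits sum to at most the other-gross count. -/
theorem sum_ballOtherCount_le (Q : PeriodicConfiguration 3) :
    (∑ x : Q.motif, ballOtherCount θ ε R r η L δ L' ϱ Q x) ≤ (Nat.card {x : Q.motif // IsOtherGross θ ε R r η L δ L' Q x} : ℝ) := by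
  rw [← sum_ballOtherCount_add_farOtherCount_eq (ϱ := ϱ) Q]
  linarith [farOtherCount_nonneg (θ := θ) (ε := ε) (R := R) (r := r) (η := η) (L := L) (δ := δ) (L' := L') (ϱ := ϱ) Q]

/-- The far debit is at most the other-gross count. -/
theorem farOtherCount_le (Q : PeriodicConfiguration 3) :
    farOtherCount θ ε R r η L δ L' ϱ Q ≤ (Nat.card {x : Q.motif // IsOtherGross θ ε R r η L δ L' Q x} : ℝ) := by
  rw [← sum_ballOtherCount_add_farOtherCount_eq (ϱ := ϱ) Q]
  linarith [Finset.sum_nonneg fun x (_ : x ∈ (Finset.univ : Finset Q.motif)) =>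
    ballOtherCount_nonneg (θ := θ) (ε := ε) (R := R) (r := r) (η := η) (L := L) (δ := δ) (L' := L') (ϱ := ϱ) Q x]

/-- Typed end: with no cores the far account is the whole excess. -/
theorem farExcess_eq_excess_of_forall_not_isCore {Q : PeriodicConfiguration 3} (h : ∀ x : Q.motif, ¬ IsCore θ ε R r η L δ L' Q x) :
    farExcess θ ε R r η L δ L' ϱ Q = excess Q := by
  rw [excess_eq_ballExcess_add_farExcess (θ := θ) (ε := ε) (R := R) (r := r) (η := η) (L := L) (δ := δ) (L' := L') (ϱ := ϱ) Q]
  simp [ballExcess_of_not_isCore (h _)]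

end Ledger

/-! ## §4 The pieces beneath NGP at a FIXED scale `ϱ` with a shared slack dial `c₁`, and the glue -/

section Pieces

variable (θ ε R r η L δ L' ϱ c₁ : ℝ)

/-- piece BALL at scale `ϱ` with slack `c₁`, restricted to a sub-species `σ` of the cores · ⚠ REFUTED AS TYPED (mathematics,
generation 48 memo §1 «rim flower», for every `σ` met by some core: `M` mutually-crowded rattlers at distance `1` from a site `z` with
`0 < ψ_x(z)`, themselves at orbit-distance `≥ ϱ` from `x`, drive `ballExcess x → −∞` at `M`-independent weighted debit; kept as the
settled negative edge of the ledger — the repair starts from the cool guard `…ChargedEnergyGapCoolGuard`) · **CORE BALL PRICING**: the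
smooth `ϱ`-ball account of every incoherent core `x` with `σ x` pays some `κ₀ > c₁` per weighted core inside, up to `C₀` per weighted
other gross charged site inside. -/
def CoreBallPricingOn (σ : ∀ Q : PeriodicConfiguration 3, Q.motif → Prop) : Prop :=
  ∃ κ₀ C₀ : ℝ, c₁ < κ₀ ∧ 0 ≤ C₀ ∧ ∀ (Q : PeriodicConfiguration 3) (x : Q.motif), IsCore θ ε R r η L δ L' Q x → σ Q x →
    κ₀ * ballCoreCount θ ε R r η L δ L' ϱ Q x - C₀ * ballOtherCount θ ε R r η L δ L' ϱ Q x ≤ ballExcess θ ε R r η L δ L' ϱ Q x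

/-- piece BALL · not implied by NGP (a localisation at the fixed scale `ϱ`) · ⚠ REFUTED AS TYPED (generation 48 memo §1, rim flower;
was: UNDECIDED · INSTRUMENTABLE) · **CORE BALL PRICING** on all incoherent cores. -/
def CoreBallPricing : Prop :=
  CoreBallPricingOn θ ε R r η L δ L' ϱ c₁ fun _ _ => True

/-- piece FAR · not implied by NGP · ⚠ REFUTED AS TYPED (generation 48 memo §1, rim flower at the flat-top edge `orbitDist = ϱ/2`:
crowders at far weight `0`, victim site at far weight `> 0`; was: TRUE-leaning · ATTACKABLE) · **FAR FLOOR** at scale `ϱ` with slack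
`c₁`: the far account is at least `−C₁` per weighted other gross charged site in it, minus `c₁` per incoherent core of the motif. -/
def FarFloor : Prop :=
  ∃ C₁ : ℝ, 0 ≤ C₁ ∧ ∀ Q : PeriodicConfiguration 3,
    -(C₁ * farOtherCount θ ε R r η L δ L' ϱ Q) - c₁ * (motifCoreIncoherent θ ε R r η L δ L' Q : ℝ) ≤
      farExcess θ ε R r η L δ L' ϱ Q

variable {θ ε R r η L δ L' ϱ c₁}

/-- Restriction is monotone in the sub-species. -/
theorem CoreBallPricingOn.mono {σ τ : ∀ Q : PeriodicConfiguration 3, Q.motif → Prop} (hστ : ∀ Q x, τ Q x → σ Q x)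
    (h : CoreBallPricingOn θ ε R r η L δ L' ϱ c₁ σ) : CoreBallPricingOn θ ε R r η L δ L' ϱ c₁ τ := by
  obtain ⟨κ₀, C₀, hκ, hC, hball⟩ := h
  exact ⟨κ₀, C₀, hκ, hC, fun Q x hx hτ => hball Q x hx (hστ Q x hτ)⟩

/-- THE SLACK DIAL TURNS: BALL is antitone in the slack … -/
theorem CoreBallPricingOn.anti {c₁' : ℝ} (hc : c₁' ≤ c₁) {σ : ∀ Q : PeriodicConfiguration 3, Q.motif → Prop}
    (h : CoreBallPricingOn θ ε R r η L δ L' ϱ c₁ σ) : CoreBallPricingOn θ ε R r η L δ L' ϱ c₁' σ := by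
  obtain ⟨κ₀, C₀, hκ, hC, hball⟩ := h
  exact ⟨κ₀, C₀, hc.trans_lt hκ, hC, hball⟩

/-- … and FAR is monotone in it. -/
theorem FarFloor.mono {c₁' : ℝ} (hc : c₁ ≤ c₁') (h : FarFloor θ ε R r η L δ L' ϱ c₁) : FarFloor θ ε R r η L δ L' ϱ c₁' := by
  obtain ⟨C₁, hC, hfar⟩ := h
  refine ⟨C₁, hC, fun Q => le_trans ?_ (hfar Q)⟩
  have : (0 : ℝ) ≤ (motifCoreIncoherent θ ε R r η L δ L' Q : ℝ) := Nat.cast_nonneg _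
  nlinarith

/-- ★ **EXACT ∀-SPLIT** of BALL along any cut `σ` of the cores: `BALL|⊤ ⟺ BALL|σ ∧ BALL|¬σ` (constants `min κ₀`, `max C₀`). -/
theorem coreBallPricing_iff_on_and_on_not (σ : ∀ Q : PeriodicConfiguration 3, Q.motif → Prop) :
    CoreBallPricing θ ε R r η L δ L' ϱ c₁ ↔
      CoreBallPricingOn θ ε R r η L δ L' ϱ c₁ σ ∧ CoreBallPricingOn θ ε R r η L δ L' ϱ c₁ fun Q x => ¬ σ Q x := by
  constructor
  · intro h
    exact ⟨h.mono fun _ _ _ => trivial, h.mono fun _ _ _ => trivial⟩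
  · rintro ⟨⟨κ₁, C₁, hκ₁, hC₁, h₁⟩, ⟨κ₂, C₂, hκ₂, hC₂, h₂⟩⟩
    refine ⟨min κ₁ κ₂, max C₁ C₂, lt_min hκ₁ hκ₂, le_max_of_le_left hC₁, fun Q x hx _ => ?_⟩
    have hcc := ballCoreCount_nonneg (θ := θ) (ε := ε) (R := R) (r := r) (η := η) (L := L) (δ := δ) (L' := L') (ϱ := ϱ) Q x
    have hoc := ballOtherCount_nonneg (θ := θ) (ε := ε) (R := R) (r := r) (η := η) (L := L) (δ := δ) (L' := L') (ϱ := ϱ) Q x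
    by_cases hσ : σ Q x
    · have := h₁ Q x hx hσ
      nlinarith [min_le_left κ₁ κ₂, le_max_left C₁ C₂]
    · have := h₂ Q x hx hσ
      nlinarith [min_le_right κ₁ κ₂, le_max_right C₁ C₂]

/-- ★★ **THE GLUE** (every parameter, every scale, every slack): BALL ∧ FAR ⟹ NGP, with `κ = κ₀ − c₁ > 0` and `C = C₀ + C₁`. -/
theorem incoherentGrossDebitPricing_of_ball_far (hB : CoreBallPricing θ ε R r η L δ L' ϱ c₁) (hF : FarFloor θ ε R r η L δ L' ϱ c₁) :
    IncoherentGrossDebitPricing θ ε R r η L δ L' := by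
  obtain ⟨κ₀, C₀, hκ, hC₀, hball⟩ := hB
  obtain ⟨C₁, hC₁, hfar⟩ := hF
  refine ⟨κ₀ - c₁, C₀ + C₁, sub_pos.2 hκ, by positivity, fun Q => ?_⟩
  have hL := excess_eq_ballExcess_add_farExcess (θ := θ) (ε := ε) (R := R) (r := r) (η := η) (L := L) (δ := δ) (L' := L') (ϱ := ϱ) Q
  have hballs : (∑ x : Q.motif, (κ₀ * ballCoreCount θ ε R r η L δ L' ϱ Q x - C₀ * ballOtherCount θ ε R r η L δ L' ϱ Q x)) ≤
      ∑ x : Q.motif, ballExcess θ ε R r η L δ L' ϱ Q x := by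
    refine Finset.sum_le_sum fun x _ => ?_
    by_cases hx : IsCore θ ε R r η L δ L' Q x
    · exact hball Q x hx trivial
    · rw [ballExcess_of_not_isCore hx, ballCoreCount_of_not_isCore hx, ballOtherCount_of_not_isCore hx]; simp
  rw [Finset.sum_sub_distrib, ← Finset.mul_sum, ← Finset.mul_sum, sum_ballCoreCount_eq] at hballs
  have hF' := hfar Q
  have hob := sum_ballOtherCount_le (θ := θ) (ε := ε) (R := R) (r := r) (η := η) (L := L) (δ := δ) (L' := L') (ϱ := ϱ) Q
  have hof := farOtherCount_le (θ := θ) (ε := ε) (R := R) (r := r) (η := η) (L := L) (δ := δ) (L' := L') (ϱ := ϱ) Q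
  have hofn := farOtherCount_nonneg (θ := θ) (ε := ε) (R := R) (r := r) (η := η) (L := L) (δ := δ) (L' := L') (ϱ := ϱ) Q
  have hobn : 0 ≤ ∑ x : Q.motif, ballOtherCount θ ε R r η L δ L' ϱ Q x :=
    Finset.sum_nonneg fun x _ => ballOtherCount_nonneg Q x
  rw [cast_motifChargedGross_sub_incoherent θ ε R r η L δ L' Q]
  nlinarith [hL, hballs, hF', hob, hof, hofn, hobn, hC₀, hC₁]

/-- BALL alone gives NGP's inequality on the ball part of the ledger, FAR alone on the far part — neither controls the other
(MustFail).  The typed end `δ ≥ 5/8` (no incoherent core, part H-A): BALL is vacuous at every scale and slack … -/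
theorem coreBallPricing_of_five_eighths_le (hδ : 5 / 8 ≤ δ) : CoreBallPricing θ ε R r η L δ L' ϱ c₁ :=
  ⟨c₁ + 1, 0, lt_add_one c₁, le_rfl, fun Q x hx _ =>
    (hx.not_coherentWithin (coherentWithin_of_five_eighths_le hδ L' Q (x : E3))).elim⟩

/-- … and FAR is `excess ≥ 0`. -/
theorem farFloor_of_five_eighths_le (hδ : 5 / 8 ≤ δ) : FarFloor θ ε R r η L δ L' ϱ c₁ := by
  refine ⟨0, le_rfl, fun Q => ?_⟩
  have hno : ∀ x : Q.motif, ¬ IsCore θ ε R r η L δ L' Q x := fun x hx =>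
    hx.not_coherentWithin (coherentWithin_of_five_eighths_le hδ L' Q _)
  rw [farExcess_eq_excess_of_forall_not_isCore hno, motifCoreIncoherent_eq_zero_of_five_eighths_le hδ, Nat.cast_zero, mul_zero,
    sub_zero, zero_mul, neg_zero]
  exact excess_nonneg' Q

/-! ### The record `(θ, ε, R, r, η, L, δ, L', ϱ, c₁) = (3/20, 1/10, 6/5, 10, 1/100, 40, 1/10, 40, 160, 1/20)` -/

/-- ★ ENGINE TARGET of record from the two ledger pieces of record. -/
theorem incoherentGrossDebitPricing_record_of_ball_far
    (hB : CoreBallPricing (3 / 20) (1 / 10) (6 / 5) 10 (1 / 100) 40 (1 / 10) 40 160 (1 / 20))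
    (hF : FarFloor (3 / 20) (1 / 10) (6 / 5) 10 (1 / 100) 40 (1 / 10) 40 160 (1 / 20)) :
    IncoherentGrossDebitPricing (3 / 20) (1 / 10) (6 / 5) 10 (1 / 100) 40 (1 / 10) 40 :=
  incoherentGrossDebitPricing_of_ball_far hB hF

/-- ★★ **RECORD CONE**, six leaves: `ChargedEnergyGap` from IP · FCP(40) · CCP · BALL · FAR · the P-side piece. -/
theorem chargedEnergyGap_of_ballLedger_record
    (hIP : ImprovablePricing (3 / 20) (1 / 10) (6 / 5) 10 (1 / 100))
    (hFCP : FrustratedCorePricing (3 / 20) (1 / 10) (6 / 5) 10 (1 / 100) 40)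
    (hCCP : CoherentCorePricing (3 / 20) (1 / 10) (6 / 5) 10 (1 / 100) 40 (1 / 10) 40)
    (hB : CoreBallPricing (3 / 20) (1 / 10) (6 / 5) 10 (1 / 100) 40 (1 / 10) 40 160 (1 / 20))
    (hF : FarFloor (3 / 20) (1 / 10) (6 / 5) 10 (1 / 100) 40 (1 / 10) 40 160 (1 / 20))
    (hP : ChartedChargePricing (3 / 20)) : ChargedEnergyGap :=
  chargedEnergyGap_of_coherenceDial_record hIP hFCP hCCP (incoherentGrossDebitPricing_of_ball_far hB hF) hP

end Pieces

end Summit.AtomisticToContinuum.Crystallization.Theorems.ChargedEnergyGapChartDial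

end
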